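import Summits.QuantumFields.QCD.Theorems.QuarksAsStableActionSmallHoppingDiamagnetismWords

/-!
# Small-hopping diamagnetism (stmt-QuantumFields-9738): the low orders of the hopping expansion

Helper file for the support item `SmallHoppingDiamagnetism` of route `QuarksAsStableAction`.
For a unitary matrix representation `ρ`, a gauge field `V` on the four-torus of side `L` and a
*flat* comparison field `V'` (all holonomies along balanced words trivial — e.g. the antiperiodic
lift of the trivial field), the orders `k < L` of `log|det(1 - κH_V)| - log|det(1 - κH_{V'})|`
are controlled word by word (closed words of length `< L` are balanced, `balanced_of_disp_eq_zero`):

* `re_trace_pow_sub_eq` (★) : `Re (tr H_Vᵏ - tr H_{V'}ᵏ) = - Σ_{w closed, |w| = k} Re tr Γ_w · wordDefect ρ V w`;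
* `closedWordSum_le` : `Σ_w … ≤ 8ᵏ · 4·2ᵏ · k⁴ · S_W(V)` (Stokes bound `wordDefect_le`, spin traces
  `‖tr Γ_w‖ ≤ 4·2ᵏ`, `8ᵏ` words);
* `closedWordSum_four_le` : at `k = 4 < L` the sum is `≤ -8 S_W(V)` (plaquette words, `tr Γ = -8`,
  all other balanced four-letter words have `Re tr Γ_w ≤ 0`);
* `closedWordSum_eq_zero` : it vanishes for `k ∈ {0, 1, 2, 3, 5}` (odd: no balanced words; `k = 2`:
  backtracks, `Γ = 0`; `k = 0`: zero deficit);
* `neg_re_term_sub_eq`, `neg_re_term_sub_le` : the order-`k` term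
  `A_k = -Re(κᵏ tr H_Vᵏ/k - κᵏ tr H_{V'}ᵏ/k) = (κᵏ/k) Σ_w …` and its bound
  `A_k ≤ ([k = 4](-2κ⁴) + [6 ≤ k] 4 (256κ)⁶ 2⁻ᵏ) · S_W(V)` for `256 κ ≤ 1`;
* `head_le` : `Σ_{k<L} A_k ≤ ([4 < L](-2κ⁴) + 8 (256κ)⁶) · S_W(V)`.

Mathlib + the sibling `…SmallHoppingDiamagnetism{Defs,Paths,Stokes,Deficit,Words}` files only.
-/

noncomputable section

namespace Summit.QuantumFields.QCD.Theorems.SmallHopping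

open Literature.Probability.LatticeModels Literature.MathematicalPhysics.QuantumLattice
  Literature.MathematicalPhysics.QuantumFieldTheory Matrix

variable {L N : ℕ} {G : Type*} [Group G] (ρ : G →* Matrix (Fin N) (Fin N) ℂ)
  (hρ : ∀ g, ρ g ∈ Matrix.unitaryGroup (Fin N) ℂ) [NeZero L]

/-! ## The word-by-word identity -/

/-- **(★) The orders below the torus size, word by word.**  For `k < L` and a comparison field `V'`
that is flat on balanced words,
`Re (tr H_Vᵏ - tr H_{V'}ᵏ) = - Σ_{|w| = k, w closed} Re tr(Γ_w) · wordDefect ρ V w`. -/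
theorem re_trace_pow_sub_eq (V V' : GaugeConfig 4 L G)
    (hV' : ∀ (x : TorusSite 4 L) (w : List Letter), balanced w = true → hol V' x w = 1)
    {k : ℕ} (hk : k < L) :
    ((hopMatrix ρ V ^ k).trace - (hopMatrix ρ V' ^ k).trace).re =
      -∑ w : Fin k → Letter, (if disp (List.ofFn w) = (0 : TorusSite 4 L) then
          ((spinWord (List.ofFn w)).trace).re * wordDefect ρ V (List.ofFn w) else 0) := by
  rw [trace_hopMatrix_pow, trace_hopMatrix_pow, ← Finset.sum_sub_distrib, Complex.re_sum,
    ← Finset.sum_neg_distrib]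
  refine Finset.sum_congr rfl fun w _ => ?_
  split_ifs with hc
  · have hbal : balanced (List.ofFn w) = true :=
      balanced_of_disp_eq_zero _ (by rw [List.length_ofFn]; exact hk) hc
    rw [← mul_sub, Complex.mul_re, trace_spinWord_im, zero_mul, sub_zero, Complex.sub_re,
      Complex.re_sum, Complex.re_sum]
    simp only [hV' _ _ hbal, map_one, Matrix.trace_one, Fintype.card_fin, Complex.natCast_re]
    unfold wordDefect defect
    rw [Finset.sum_sub_distrib]
    ring
  · simp

/-! ## Bounds on the closed-word sums -/

include hρ in
/-- Every term of the closed-word sum is bounded by `4·2ᵏ·k⁴·S_W(V)` in modulus (for `k < L`). -/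
theorem closedWord_term_abs_le (V : GaugeConfig 4 L G) {k : ℕ} (hk : k < L) (w : Fin k → Letter) :
    |(if disp (List.ofFn w) = (0 : TorusSite 4 L) then
        ((spinWord (List.ofFn w)).trace).re * wordDefect ρ V (List.ofFn w) else 0)| ≤
      4 * 2 ^ k * (k : ℝ) ^ 4 * wilsonAction ρ V := by
  have hS := wilsonAction_nonneg' ρ hρ V
  split_ifs with hc
  · have hbal : balanced (List.ofFn w) = true :=
      balanced_of_disp_eq_zero _ (by rw [List.length_ofFn]; exact hk) hc
    have h1 : |((spinWord (List.ofFn w)).trace).re| ≤ 4 * 2 ^ k := by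
      calc |((spinWord (List.ofFn w)).trace).re| ≤ ‖(spinWord (List.ofFn w)).trace‖ :=
            Complex.abs_re_le_norm _
        _ ≤ 4 * 2 ^ (List.ofFn w).length := norm_trace_spinWord_le _
        _ = 4 * 2 ^ k := by rw [List.length_ofFn]
    have h2 : 0 ≤ wordDefect ρ V (List.ofFn w) :=
      Finset.sum_nonneg fun x _ => defect_nonneg ρ hρ _
    have h3 : wordDefect ρ V (List.ofFn w) ≤ (k : ℝ) ^ 4 * wilsonAction ρ V := by
      have := wordDefect_le ρ hρ (List.ofFn w) hbal V
      rwa [List.length_ofFn] at this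
    rw [abs_mul, abs_of_nonneg h2]
    calc |((spinWord (List.ofFn w)).trace).re| * wordDefect ρ V (List.ofFn w)
        ≤ (4 * 2 ^ k) * ((k : ℝ) ^ 4 * wilsonAction ρ V) :=
          mul_le_mul h1 h3 h2 (by positivity)
      _ = 4 * 2 ^ k * (k : ℝ) ^ 4 * wilsonAction ρ V := by ring
  · rw [abs_zero]; positivity

include hρ in
/-- **Generic order**: the closed-word sum of length `k < L` is at most `8ᵏ · 4·2ᵏ · k⁴ · S_W(V)`. -/
theorem closedWordSum_le (V : GaugeConfig 4 L G) {k : ℕ} (hk : k < L) :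
    ∑ w : Fin k → Letter, (if disp (List.ofFn w) = (0 : TorusSite 4 L) then
        ((spinWord (List.ofFn w)).trace).re * wordDefect ρ V (List.ofFn w) else 0) ≤
      8 ^ k * (4 * 2 ^ k * (k : ℝ) ^ 4 * wilsonAction ρ V) := by
  calc ∑ w : Fin k → Letter, (if disp (List.ofFn w) = (0 : TorusSite 4 L) then
        ((spinWord (List.ofFn w)).trace).re * wordDefect ρ V (List.ofFn w) else 0)
      ≤ ∑ _w : Fin k → Letter, 4 * 2 ^ k * (k : ℝ) ^ 4 * wilsonAction ρ V :=
        Finset.sum_le_sum fun w _ => (le_abs_self _).trans (closedWord_term_abs_le ρ hρ V hk w)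
    _ = 8 ^ k * (4 * 2 ^ k * (k : ℝ) ^ 4 * wilsonAction ρ V) := by
        rw [Finset.sum_const, Finset.card_univ, card_words, nsmul_eq_mul]
        push_cast
        ring

/-- The word of a function `Fin 4 → Letter` spelled out. -/
theorem ofFn_four (w : Fin 4 → Letter) : List.ofFn w = [w 0, w 1, w 2, w 3] := by
  simp [List.ofFn_succ]

include hρ in
/-- Every term of the closed-word sum of length four is nonpositive (`L > 4`). -/
theorem closedWord_term_four_nonpos (V : GaugeConfig 4 L G) (h4 : 4 < L) (w : Fin 4 → Letter) :
    (if disp (List.ofFn w) = (0 : TorusSite 4 L) then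
        ((spinWord (List.ofFn w)).trace).re * wordDefect ρ V (List.ofFn w) else 0) ≤ 0 := by
  split_ifs with hc
  · have hbal : balanced (List.ofFn w) = true :=
      balanced_of_disp_eq_zero _ (by rw [List.length_ofFn]; exact h4) hc
    have h1 : ((spinWord (List.ofFn w)).trace).re ≤ 0 := by
      rw [ofFn_four] at hbal ⊢
      exact re_trace_spinWord_four_le _ _ _ _ hbal
    have h2 : 0 ≤ wordDefect ρ V (List.ofFn w) :=
      Finset.sum_nonneg fun x _ => defect_nonneg ρ hρ _
    exact mul_nonpos_of_nonpos_of_nonneg h1 h2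
  · exact le_rfl

/-- The canonical plaquette word of a plane `μ < ν`, as a function `Fin 4 → Letter`. -/
theorem plaquetteFn_injective :
    Function.Injective (fun q : {p : Fin 4 × Fin 4 // p.1 < p.2} =>
      (![(q.1.1, true), (q.1.2, true), (q.1.1, false), (q.1.2, false)] : Fin 4 → Letter)) := by
  intro q q' h
  have h0 := congrFun h 0
  have h1 := congrFun h 1
  simp only [Matrix.cons_val_zero, Matrix.cons_val_one, Prod.mk.injEq, and_true] at h0 h1
  exact Subtype.ext (Prod.ext h0 h1)

include hρ in
/-- **The plaquette order**: for `4 < L` the closed-word sum of length four is at most `-8 S_W(V)`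
(the six canonical plaquette words contribute `-8 · Σ_x defect(U_{μν}(x))` each, all other terms are
nonpositive). -/
theorem closedWordSum_four_le (V : GaugeConfig 4 L G) (h4 : 4 < L) :
    ∑ w : Fin 4 → Letter, (if disp (List.ofFn w) = (0 : TorusSite 4 L) then
        ((spinWord (List.ofFn w)).trace).re * wordDefect ρ V (List.ofFn w) else 0) ≤
      -8 * wilsonAction ρ V := by
  classical
  set t : (Fin 4 → Letter) → ℝ := fun w => if disp (List.ofFn w) = (0 : TorusSite 4 L) then
        ((spinWord (List.ofFn w)).trace).re * wordDefect ρ V (List.ofFn w) else 0 with ht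
  set pw : {p : Fin 4 × Fin 4 // p.1 < p.2} → (Fin 4 → Letter) := fun q =>
      ![(q.1.1, true), (q.1.2, true), (q.1.1, false), (q.1.2, false)]
  -- the canonical words evaluate to `-8 · planeDefect`
  have hval : ∀ q : {p : Fin 4 × Fin 4 // p.1 < p.2},
      t ![(q.1.1, true), (q.1.2, true), (q.1.1, false), (q.1.2, false)] =
        -8 * planeDefect ρ V q.1.1 q.1.2 := by
    intro q
    have hne : ((q.1.1, true) : Letter).1 ≠ ((q.1.2, true) : Letter).1 := ne_of_lt q.2
    rw [ht]
    dsimp only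
    rw [ofFn_plaquetteWord, if_pos (disp_plaquetteWord _ _),
      show [(q.1.1, true), (q.1.2, true), (q.1.1, false), (q.1.2, false)] =
        [((q.1.1, true) : Letter), (q.1.2, true), Letter.inv (q.1.1, true), Letter.inv (q.1.2, true)]
        from rfl,
      trace_spinWord_plaquette _ _ hne]
    unfold wordDefect planeDefect
    simp only [Letter.inv, Bool.not_true, hol_plaquetteWord]
    norm_num
  -- all terms nonpositive, so the full sum is below the sum over the canonical words
  have hle : ∑ w, t w ≤ ∑ w ∈ Finset.univ.image pw, t w := by
    have hneg : ∑ w ∈ Finset.univ.image pw, -t w ≤ ∑ w, -t w :=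
      Finset.sum_le_sum_of_subset_of_nonneg (Finset.subset_univ _)
        (fun w _ _ => neg_nonneg.mpr (closedWord_term_four_nonpos ρ hρ V h4 w))
    rw [Finset.sum_neg_distrib, Finset.sum_neg_distrib] at hneg
    linarith
  refine hle.trans ?_
  rw [Finset.sum_image fun q _ q' _ h => plaquetteFn_injective h,
    Finset.sum_congr rfl fun q _ => hval q, ← Finset.mul_sum, wilsonAction_eq_sum_sum,
    Finset.sum_comm]
  rfl

/-- **The trivial orders**: for `k < L` with `k < 6`, `k ≠ 4`, the closed-word sum vanishes
(odd `k`: no balanced words; `k = 2`: backtracks have `Γ = 0`; `k = 0`: zero deficit). -/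
theorem closedWordSum_eq_zero (V : GaugeConfig 4 L G) {k : ℕ} (hk : k < L) (hk6 : k < 6)
    (hk4 : k ≠ 4) :
    ∑ w : Fin k → Letter, (if disp (List.ofFn w) = (0 : TorusSite 4 L) then
        ((spinWord (List.ofFn w)).trace).re * wordDefect ρ V (List.ofFn w) else 0) = 0 := by
  refine Finset.sum_eq_zero fun w _ => ?_
  split_ifs with hc
  · have hbal : balanced (List.ofFn w) = true :=
      balanced_of_disp_eq_zero _ (by rw [List.length_ofFn]; exact hk) hc
    have heven := even_length_of_balanced k (List.ofFn w) (by rw [List.length_ofFn]) hbal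
    rw [List.length_ofFn] at heven
    obtain ⟨j, hj⟩ := heven
    have hk02 : k = 0 ∨ k = 2 := by omega
    rcases hk02 with rfl | rfl
    · -- the empty word: zero deficit
      have h0 : wordDefect ρ V (List.ofFn w) = 0 := by
        unfold wordDefect
        refine Finset.sum_eq_zero fun x _ => ?_
        rw [List.ofFn_zero, hol_nil, defect_one]
      rw [h0, mul_zero]
    · -- backtracks: vanishing spin factor
      have hw2 : List.ofFn w = [w 0, w 1] := by simp [List.ofFn_succ]
      rw [hw2] at hbal ⊢
      rw [eq_inv_of_balanced_two _ _ hbal,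
        show [w 0, (w 0).inv] = [] ++ (w 0) :: (w 0).inv :: [] from rfl, spinWord_cons_cons_inv,
        Matrix.trace_zero, Complex.zero_re, zero_mul]
  · rfl

/-! ## The order-`k` terms of the expansion -/

/-- The order-`k` term of the difference of the two expansions, as a real multiple of the
closed-word sum: `-Re(κᵏ tr H_Vᵏ/k - κᵏ tr H_{V'}ᵏ/k) = (κᵏ/k) · Σ_w …` (`k < L`). -/
theorem neg_re_term_sub_eq (V V' : GaugeConfig 4 L G)
    (hV' : ∀ (x : TorusSite 4 L) (w : List Letter), balanced w = true → hol V' x w = 1)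
    (κ : ℝ) {k : ℕ} (hk : k < L) :
    -((κ : ℂ) ^ k * (hopMatrix ρ V ^ k).trace / k - (κ : ℂ) ^ k * (hopMatrix ρ V' ^ k).trace / k).re =
      κ ^ k / k * ∑ w : Fin k → Letter, (if disp (List.ofFn w) = (0 : TorusSite 4 L) then
          ((spinWord (List.ofFn w)).trace).re * wordDefect ρ V (List.ofFn w) else 0) := by
  have h1 : (κ : ℂ) ^ k * (hopMatrix ρ V ^ k).trace / k - (κ : ℂ) ^ k * (hopMatrix ρ V' ^ k).trace / k =
      ((κ ^ k / k : ℝ) : ℂ) * ((hopMatrix ρ V ^ k).trace - (hopMatrix ρ V' ^ k).trace) := by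
    push_cast
    ring
  rw [h1, Complex.re_ofReal_mul, re_trace_pow_sub_eq ρ V V' hV' hk, mul_neg, neg_neg]

/-- `k³ ≤ 8ᵏ`. -/
theorem pow_three_le_eight_pow (k : ℕ) : (k : ℝ) ^ 3 ≤ 8 ^ k := by
  have h : (k : ℝ) < 2 ^ k := by exact_mod_cast Nat.lt_two_pow_self
  calc (k : ℝ) ^ 3 ≤ (2 ^ k) ^ 3 := pow_le_pow_left₀ (Nat.cast_nonneg k) h.le 3
    _ = 8 ^ k := by rw [← pow_mul, mul_comm, pow_mul]; norm_num

include hρ in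
/-- **Order-by-order bound.**  For `k < L`, `0 ≤ κ`, `256 κ ≤ 1`:
`A_k ≤ ([k = 4] (-2κ⁴) + [6 ≤ k] 4 (256κ)⁶ 2⁻ᵏ) · S_W(V)`. -/
theorem neg_re_term_sub_le (V V' : GaugeConfig 4 L G)
    (hV' : ∀ (x : TorusSite 4 L) (w : List Letter), balanced w = true → hol V' x w = 1)
    {κ : ℝ} (hκ0 : 0 ≤ κ) (hκ1 : κ * 256 ≤ 1) {k : ℕ} (hk : k < L) :
    -((κ : ℂ) ^ k * (hopMatrix ρ V ^ k).trace / k - (κ : ℂ) ^ k * (hopMatrix ρ V' ^ k).trace / k).re ≤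
      ((if k = 4 then -2 * κ ^ 4 else 0) + (if 6 ≤ k then 4 * (κ * 256) ^ 6 * (1 / 2) ^ k else 0)) *
        wilsonAction ρ V := by
  have hS := wilsonAction_nonneg' ρ hρ V
  rw [neg_re_term_sub_eq ρ V V' hV' κ hk]
  by_cases h4 : k = 4
  · subst h4
    rw [if_pos rfl, if_neg (by norm_num), add_zero]
    have h := closedWordSum_four_le ρ hρ V hk
    have hκ4 : 0 ≤ κ ^ 4 / (4 : ℕ) := by positivity
    calc κ ^ 4 / (4 : ℕ) * _ ≤ κ ^ 4 / (4 : ℕ) * (-8 * wilsonAction ρ V) :=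
          mul_le_mul_of_nonneg_left h hκ4
      _ = -2 * κ ^ 4 * wilsonAction ρ V := by push_cast; ring
  rw [if_neg h4, zero_add]
  by_cases h6 : 6 ≤ k
  · rw [if_pos h6]
    have h := closedWordSum_le ρ hρ V hk
    have hk0 : (0 : ℝ) < k := by exact_mod_cast (show 0 < k by omega)
    have hκk : 0 ≤ κ ^ k / k := by positivity
    calc κ ^ k / k * _ ≤ κ ^ k / k * (8 ^ k * (4 * 2 ^ k * (k : ℝ) ^ 4 * wilsonAction ρ V)) :=
          mul_le_mul_of_nonneg_left h hκk
      _ = 4 * (κ ^ k * (2 ^ k * 8 ^ k * (k : ℝ) ^ 3)) * wilsonAction ρ V := by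
          field_simp
      _ ≤ 4 * ((κ * 256) ^ 6 * (1 / 2) ^ k) * wilsonAction ρ V := by
          apply mul_le_mul_of_nonneg_right _ hS
          apply mul_le_mul_of_nonneg_left _ (by norm_num)
          have h3 := pow_three_le_eight_pow k
          have h128 : (2 : ℝ) ^ k * 8 ^ k * 8 ^ k = 128 ^ k := by
            rw [← mul_pow, ← mul_pow]; norm_num
          calc κ ^ k * (2 ^ k * 8 ^ k * (k : ℝ) ^ 3) ≤ κ ^ k * (2 ^ k * 8 ^ k * 8 ^ k) := by gcongr
            _ = (κ * 256) ^ k * (1 / 2) ^ k := by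
                rw [h128, ← mul_pow, ← mul_pow]
                congr 1
                ring
            _ ≤ (κ * 256) ^ 6 * (1 / 2) ^ k := by
                apply mul_le_mul_of_nonneg_right _ (by positivity)
                exact pow_le_pow_of_le_one (by positivity) hκ1 h6
      _ = 4 * (κ * 256) ^ 6 * (1 / 2) ^ k * wilsonAction ρ V := by ring
  · rw [if_neg h6, closedWordSum_eq_zero ρ V hk (by omega) h4, mul_zero, zero_mul]

include hρ in
/-- **The head of the expansion.**  For `0 ≤ κ`, `256 κ ≤ 1`:
`-Re Σ_{k<L} (κᵏ tr H_Vᵏ/k - κᵏ tr H_{V'}ᵏ/k) ≤ ([4 < L](-2κ⁴) + 8 (256κ)⁶) · S_W(V)`. -/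
theorem head_le (V V' : GaugeConfig 4 L G)
    (hV' : ∀ (x : TorusSite 4 L) (w : List Letter), balanced w = true → hol V' x w = 1)
    {κ : ℝ} (hκ0 : 0 ≤ κ) (hκ1 : κ * 256 ≤ 1) :
    -(∑ k ∈ Finset.range L, ((κ : ℂ) ^ k * (hopMatrix ρ V ^ k).trace / k -
        (κ : ℂ) ^ k * (hopMatrix ρ V' ^ k).trace / k)).re ≤
      ((if 4 < L then -2 * κ ^ 4 else 0) + 8 * (κ * 256) ^ 6) * wilsonAction ρ V := by
  have hS := wilsonAction_nonneg' ρ hρ V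
  rw [Complex.re_sum, ← Finset.sum_neg_distrib]
  calc ∑ k ∈ Finset.range L, -((κ : ℂ) ^ k * (hopMatrix ρ V ^ k).trace / k -
          (κ : ℂ) ^ k * (hopMatrix ρ V' ^ k).trace / k).re
      ≤ ∑ k ∈ Finset.range L, ((if k = 4 then -2 * κ ^ 4 else 0) +
          (if 6 ≤ k then 4 * (κ * 256) ^ 6 * (1 / 2) ^ k else 0)) * wilsonAction ρ V :=
        Finset.sum_le_sum fun k hk => neg_re_term_sub_le ρ hρ V V' hV' hκ0 hκ1 (Finset.mem_range.mp hk)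
    _ = ((∑ k ∈ Finset.range L, (if k = 4 then -2 * κ ^ 4 else 0)) +
          ∑ k ∈ Finset.range L, (if 6 ≤ k then 4 * (κ * 256) ^ 6 * (1 / 2) ^ k else 0)) *
          wilsonAction ρ V := by
        rw [← Finset.sum_mul, Finset.sum_add_distrib]
    _ ≤ ((if 4 < L then -2 * κ ^ 4 else 0) + 8 * (κ * 256) ^ 6) * wilsonAction ρ V := by
        apply mul_le_mul_of_nonneg_right _ hS
        apply add_le_add
        · rw [Finset.sum_ite_eq']
          simp only [Finset.mem_range, le_refl]
        · calc ∑ k ∈ Finset.range L, (if 6 ≤ k then 4 * (κ * 256) ^ 6 * (1 / 2) ^ k else (0 : ℝ))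
              ≤ ∑ k ∈ Finset.range L, 4 * (κ * 256) ^ 6 * (1 / 2) ^ k := by
                refine Finset.sum_le_sum fun k _ => ?_
                split_ifs
                · exact le_rfl
                · positivity
            _ = 4 * (κ * 256) ^ 6 * ∑ k ∈ Finset.range L, (1 / 2 : ℝ) ^ k := by
                rw [Finset.mul_sum]
            _ ≤ 4 * (κ * 256) ^ 6 * 2 := by
                apply mul_le_mul_of_nonneg_left _ (by positivity)
                have := sum_geometric_two_le L
                exact this
            _ = 8 * (κ * 256) ^ 6 := by ring

end Summit.QuantumFields.QCD.Theorems.SmallHopping
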